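import Mathlib
import HarnessLib

/-!
# Magnen–Rivasseau–Sénéor, *Construction of YM₄ with an infrared cutoff* (CMP 155, 1993) — the MAIN STATEMENT
# (p. 327, unnumbered, italic) AS PRINTED: a typed skeleton of its logical shape, its printed scope, and the
# Sect. VIII reduction «approximate Slavnov identities + δ_N(ρ) → 0 ⇒ (VIII.6)» kernel-checked

statement-level skeleton of a published CLAIM with citation tags; the elementary reduction proved; nothing here is a
claim about the Yang–Mills mass gap, about continuum Yang–Mills on `T⁴` without infrared cutoff, or about the Clay
problem — and nothing of Magnen–Rivasseau–Sénéor's analysis is asserted or formalised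

**Citation header (reproduction of PUBLISHED work).** J. Magnen, V. Rivasseau, R. Sénéor, *Construction of YM₄ with
an infrared cutoff*, Commun. Math. Phys. **155** (1993) 325–383 [MagnenRivasseauSeneor1993] (received 17 Feb 1992,
revised 8 Sep 1992). Loci `p.NNN tl.nn` = journal page and text-layer line of the held Project-Euclid scan
`paper:magnen1993-cmp155-mrs-ym4-infrared-cutoff` (PDF page = journal page − 324); the two displays this file renders,
the main statement (p. 327) and (VIII.6) (p. 378), were re-read on the decoded 600 dpi page images (renders of record
`run/shared/lean/pub/lit-balaban/inprint/lit-balaban-p14/renders-cmp155/`; crops `p03_crop_r3950-4750_s2.png`,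
`p54_crop_r450-3000_s2.png` in the seat folder of unit `pub-balaban-gaps-mrs-lit-1`). Cell pub-balaban-gaps, track G3
(«MRS 1993 typed AS PRINTED as the independent second ultraviolet route»), seat mrs-lit-1; companion prose
`run/shared/lean/pub/pub-balaban-gaps/g3/MRS-AS-PRINTED.md`; prior reads of record: lit-balaban `YM-INPRINT.md` row D1
(grade: SKETCH overall, by the authors' own designation; PROOF-grade components Lemma III.1 and Lemma VI.1 given VI.2).
Sibling modules: `…MRS93StartingAnsatz` ((II.11)–(II.15): the bare coupling, the stabilizing cutoff class — real
definitions) and `…MRS93OneLoopCounterterms` (Sect. III arithmetic). The older schematic rendering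
`Literature.MathematicalPhysics.QuantumFieldTheory.MagnenRivasseauSeneorYM4` (inventory item constructive-qft.S21 in
`…ConstructiveQFTBalabanRG`, shown to admit an artificial witness in `…ConstructiveQFTBalabanRGMRSProofs`) is NOT
used or restated here: this file types the printed sentence over an abstract carrier, B12-style (cf.
`…Balaban1983to89.B12`: carriers + `…Printed` predicates), and proves only bookkeeping.

**THE MAIN STATEMENT, verbatim** (p.327 tl.39–43, italic in print, no theorem number; preceded by *«In conclusion
our statement can be formulated as follows:»*):

  *«The ultraviolet limit as ρ → ∞ of the Schwinger functions which are the moments of the bare measure defined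
  below in (II.77) exists; futhermore [sic] these functions in the ultraviolet limit satisfy the Slavnov identities
  (VIII.6) adapted to the particular infrared cutoff chosen.»*

followed at once by (tl.44–48): *«In this paper we do not provide a detailed proof of this statement but we give all
the elements necessary to write such a proof, emphasizing those aspects which we consider technically the most
difficult and original. We think that the writing up of such a detailed self-contained proof, which would presumably
be several hundred pages long, remains an extremely valuable task.»* See also p.326 tl.22–25 *«We do not claim to
provide here the proofs of convergence of our expansion in all detail. However we think that this paper … both
provides a detailed outline of these proofs and remains relatively short»*, p.327 tl.12–15 *«we show that the
Schwinger functions that we construct satisfy the Slavnov identities … This is our main result, formulated at the end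
of Sect. VIII»*, and the paper's last sentence before the appendix, p.378 tl.25: *«This achieves our sketch of proof
of the main statement in the introduction.»* STATUS IN PRINT, therefore: a CLAIM with a self-declared SKETCH of
proof. It is typed here (`MainStatementPrinted`) as a PREDICATE on an abstract carrier so that other modules can
take it as an explicit hypothesis; it is not, and must not be recorded as, a theorem of the literature.

**«(II.77)» [sic].** The display numbered (II.77) in print (p.346) is the cut-off Faddeev–Popov determinant
`det|Δ − λκ_ρ(p)(∂[A′_s, ·] + Σ_j[κ_j ∗ B′_l, κ^j ∗ ∂·])|`; the bare measure the sentence means is the functional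
measure assembled in (II.49) p.342 and recapitulated as (II.78) p.347 tl.2–7 (*«Let us recapitulate our starting
point: Σ_LFR ∫ dμ_{0,ρ₁}(A′) dν_{ρ₂}(γ) χ_LFR(A) G(A′, γ) e^{−Σ_i(λ^{1/2+2ε₂}γ^i)^N}
× e^{−(1/2)⟨A′,[(κ_ρ)⁻¹ − 1](p²)A′⟩} e^{CT_ρ(A′)} × e^{(1/2)(−F²_sp(A) − ⟨A, p₀²A⟩ + Σ_i λ²⟨A,(p²κ^i(p))A⟩)}
[K_{ρ,ρ₂}(A′, γ)]⁻¹ × e^{−(ζ/2)(∇_{B′_l}·A′_s)²} L_{0,ρ₁}(γ) F(A′₀, γ), (II.78) where K_{ρ,ρ₂} is defined by (II.76),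
and we can fix e.g. N = 100 in what follows.»*), into which (II.77) enters through `K_{ρ,ρ₂}` (II.76). We quote the
number as printed and read it as (II.78).

**THE PRINTED SETTING (scope), verbatim, = the standing hypotheses of `MainStatementPrinted`.**
* (S1) model: *«the pure SU(2) Yang-Mills field theory in four dimensions (in the trivial topological sector) with a
  fixed infrared cutoff but no ultraviolet cutoff, in a regularized axial gauge»* (abstract, p.325 tl.9–12); *«This is
  only true for the SU(2) theory, for an SU(N) theory there would be a longer list of operators to consider and the
  analysis would be more complicated»* (p.347 tl.25–27).
* (S2) infrared cutoff: *«We consider the pure Yang-Mills theory with an infrared cutoff, which we never try to lift.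
  This cutoff may be imposed on the propagator, or we could consider the theory on a finite volume with some boundary
  conditions, or on the sphere S⁴, the torus Λ = ℝ⁴/ℤ⁴ or another compact Riemannian fourdimensional manifold. … For
  instance in the case of the torus with the trivial SU(2) bundle … Moreover the constant fields or the zero mode in
  Fourier space is deleted in all our functional integrals, hence there is no infrared problem.»* (p.328 tl.4–15);
  *«we do not try to remove the infrared cutoff, since this would lead to large values of the coupling constant, and
  presumably to so-called non-perturbative effects corresponding to confinement»* (p.327 tl.24–26).
* (S3) gauge: *«Our starting point is the Yang-Mills theory in the axial gauge. This gauge is defined by the condition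
  A₀ = 0. (II.7)»* (p.329 tl.20–21); *«such an axial gauge condition a priori is not complete … We do not fix this
  remaining invariance yet. Remark also that (II.7) is not Euclidean invariant, and the corresponding correlation
  functions are therefore not Euclidean invariant.»* (p.329 tl.29–34); *«for the moment it is limited to the axial
  gauge»* (p.327 tl.16–17); small-field regions use the background-dependent homothetic gauge with parameter ζ
  *«which takes a value close to 3/13»* (p.332 tl.40–p.333 tl.1).
* (S4) ultraviolet cutoff: scale `M^ρ`, *«the ultraviolet limit is when ρ → ∞»* (p.330 tl.14–15); the stabilizing
  class (II.13)–(II.14) with *«η … sufficiently small»* (p.331 tl.9–12) — typed in `…MRS93StartingAnsatz`; *«the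
  stability property that we require for our ultraviolet cutoff allows many different cutoffs but certainly for the
  moment rules out many others»* (p.327 tl.19–21); auxiliary cutoffs `ρ ≪ ρ₂ ≪ ρ₁` (p.340 tl.15) whose *«effect on
  any fixed scale vanishes in the limit ρ → ∞»* (p.340 tl.43).
* (S5) bare coupling: the ansatz (II.11) with *«C … a large constant»*, λ_ren *«arbitrarily small as C becomes
  arbitrarily large (if perturbative renormalization group analysis turns out to be correct)»* (p.330 tl.16–26).
* (S6) not investigated: *«invariance under large gauge transformations and non-trivial topological effects such as
  instantons»* (p.327 tl.23–24); *«we cannot study the complete set of Osterwalder-Schrader axioms … However we think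
  that the main axiom, the OS positivity, could be shown to hold with some additional work»* (p.327 tl.29–32); gauge
  invariant observables / composite operators *«we do not provide the corresponding constructions in this paper»*
  (p.329 tl.36–38).

**(VIII.6) and the printed reduction** (p.378 tl.2–25). (VIII.6): *«⟨Σ_{i=1}^{N−1}(Π_{j=1, j≠i}^{N−1}
A^{a_j}_{m_j}(x_j)) D^{a_i b}_{m_i} δ(x_i − y) − Π_{j=1}^{N−1} A^{a_j}_{m_j}(x_j)[∂/∂yⁿ A^b_n(y)](∂/∂y⁰)²⟩_ax =
E_N({x_j}), (VIII.6) where E_N can be computed for any given infrared cutoff.»* Then: *«The identities (VIII.6) are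
those that we are going to check in the limit ρ → ∞. In order to prove them we write first approximate identities
which are satisfied for the theory with cutoffs (both infrared and ultraviolet) and gauge restoring counterterms.
These identities take the form of equality between the left-hand side of (VIII.6) where ⟨·⟩_ax is replaced by
⟨·⟩_{ax,ρ}, the normalized functional integral of our theory with cutoff and a right-hand side which is no longer
E_N, but E_N + δ_N(ρ) … When ρ → ∞, the left-hand side, made of normalized Schwinger functions with cutoff ρ, by
definition tends to the same Schwinger functions without ultraviolet cutoff that we have constructed. Our expansion
proves that in the right-hand side the error term δ_N(ρ) tends to zero, because it is made of contributions tied to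
the ultraviolet cutoff. This achieves our sketch of proof of the main statement in the introduction.»*

**What is typed here.** `AxialTheory` = the abstract carrier: for each ultraviolet index `ρ : ℕ` the normalized
Schwinger functions `S ρ N f` (moments of (II.78), expectation `⟨·⟩_{ax,ρ}`) on abstract test data `Test N`, the
left-hand side of (VIII.6) as a functional `wardLHS` of a family of Schwinger functions on abstract Ward test data
`WTest N`, and the infrared correction `E`. `UVLimitExistsPrinted` (first half of the sentence, limit read
test-datum-wise), `AxialTheory.Slim` (the limit values, Mathlib `limUnder`), `SlavnovPrinted` ((VIII.6) for the
limit), **`MainStatementPrinted`** = their conjunction; `ApproximateSlavnovPrinted` and `WardLimitPrinted` = the two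
printed ingredients of p.378; **`mainStatementPrinted_of_sectVIII`**: limit exists ∧ LHS_ρ → LHS_∞ ∧ LHS_ρ = E_N +
δ_N(ρ) ∧ δ_N(ρ) → 0 ⟹ `MainStatementPrinted` (uniqueness of limits in `ℝ` — the whole printed reduction, and the
exact list of what the paper's expansion must deliver); `Construction` = parameters `(η, C) ↦ AxialTheory` and
`MainStatementEventually` = OUR READING of «η sufficiently small», «C large»: `∀ᶠ η in 𝓝[>] 0, ∀ᶠ C in atTop, …`
(the print fixes no order of these thresholds; this reading lets the `C`-threshold depend on `η`).

**Readings (declared).** (i) «the ultraviolet limit … of the Schwinger functions … exists» is read as convergence of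
each `N`-point function on each test datum (weak convergence); the print does not name a topology. (ii) `ρ ∈ ℕ`
(slice index). (iii) Everything the sentence presupposes — the torus, SU(2), the axial gauge, the bare measure
(II.78) with its eleven factors, the coupling (II.11), the cutoffs (II.13)–(II.15), (II.36), the counterterms
(III.1), the tensor/derivative structure of (VIII.6) — is FIXED INSIDE the carrier and described, not constructed:
the rendering fixes the LOGICAL SHAPE of the printed claim (what is quantified, what converges, which identity), not
its analytic content, exactly as `…Balaban1983to89.B12` does for Bałaban's Theorems 1–3. A faithful construction of
(II.78) over Mathlib (Gaussian measures on 𝒮′(T⁴) ⊗ su(2) perturbed by the non-integrable densities of (II.78),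
«formal» by the authors' word p.332 tl.10–12) is not available and is not attempted.

**What is NOT claimed.** That `MainStatementPrinted` holds for MRS's measure (the paper's own grade is «sketch of
proof»; V. Rivasseau, *Constructive field theory and applications*, J. Math. Phys. 41 (2000), arXiv:math-ph/0006017
p.3, lists «Construct the Yang Mills 4 correlation functions in a finite volume and a standard gauge» among open
problems); anything uniform in the infrared cutoff; Euclidean invariance, OS positivity, gauge-invariant observables,
a mass gap; anything about Bałaban's lattice programme or about `Summits/…/ContinuumYM4Torus`.
-/

noncomputable section

open Filter Topology

namespace Literature.MathematicalPhysics.QuantumFieldTheory.MagnenRivasseauSeneor1993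

namespace MainStatement

/-- The abstract carrier of the objects the main statement (p.327) speaks about, for ONE infrared cutoff, ONE value
of the parameters (η of (II.14), C of (II.11), ζ, ε₁, ε₂, N = 100, …) and the auxiliary cutoffs `ρ₂(ρ)`, `ρ₁(ρ)`:
`Test N` = test data of an `N`-point function (N test functions on the torus with Lorentz/colour indices — p.377
tl.34–35 *«We should of course understand this identity as applied to two test functions of x and y»*); `S ρ N f` =
the normalized `N`-point Schwinger function with ultraviolet cutoff `ρ`, i.e. the moment of the bare measure (II.78)
(printed «(II.77)»), the expectation `⟨·⟩_{ax,ρ}` of p.378 tl.17; `WTest N` = test data of the `N`-source Slavnov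
identity (VIII.6) (points `x_1 … x_{N−1}`, `y`, indices `a_j, m_j, b, n`); `wardLHS G N x` = the left-hand side of
(VIII.6) evaluated with the family of Schwinger functions `G` in place of `⟨·⟩_ax` (it is «made of normalized
Schwinger functions», p.378 tl.20–21); `E N x` = `E_N({x_j})`, which *«can be computed for any given infrared
cutoff»* (p.378 tl.9). Schematic by design: see the module docstring, Readings (iii).
[cite: MagnenRivasseauSeneor1993, p.327 and (II.78) p.347, (VIII.6) p.378] -/
structure AxialTheory where
  /-- test data for `N`-point functions -/
  Test : ℕ → Type
  /-- test data for the `N`-source identity (VIII.6) -/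
  WTest : ℕ → Type
  /-- `S ρ N f` : cutoff-`ρ` normalized Schwinger functions = moments of (II.78) -/
  S : ℕ → (N : ℕ) → Test N → ℝ
  /-- left-hand side of (VIII.6) as a functional of a family of Schwinger functions -/
  wardLHS : ((N : ℕ) → Test N → ℝ) → (N : ℕ) → WTest N → ℝ
  /-- the infrared correction `E_N` of (VIII.6) -/
  E : (N : ℕ) → WTest N → ℝ

namespace AxialTheory

variable (T : AxialTheory)

/-- The ultraviolet-limit Schwinger functions — *«the same Schwinger functions without ultraviolet cutoff that we have
constructed»* (p.378 tl.21–22) — as limit VALUES `lim_{ρ→∞} S ρ N f` (Mathlib `limUnder`; meaningful exactly when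
the limit exists, cf. `Slim_spec`). [cite: MagnenRivasseauSeneor1993, p.327 tl.40–41 and p.378 tl.20–22] -/
def Slim (N : ℕ) (f : T.Test N) : ℝ := limUnder atTop (fun ρ => T.S ρ N f)

/-- If the cutoff Schwinger function converges, it converges to `Slim` (the limit the sentence p.327 tl.40–41
asserts to exist). [cite: MagnenRivasseauSeneor1993, p.327 tl.40–41] -/
theorem Slim_spec {N : ℕ} {f : T.Test N} (h : ∃ L, Tendsto (fun ρ => T.S ρ N f) atTop (𝓝 L)) :
    Tendsto (fun ρ => T.S ρ N f) atTop (𝓝 (T.Slim N f)) :=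
  tendsto_nhds_limUnder h

/-- The left-hand side of (VIII.6) in the cutoff theory: *«the left-hand side of (VIII.6) where ⟨·⟩_ax is replaced
by ⟨·⟩_{ax,ρ}, the normalized functional integral of our theory with cutoff»* (p.378 tl.16–18).
[cite: MagnenRivasseauSeneor1993, p.378 tl.16–18] -/
def wardLHSCutoff (ρ N : ℕ) (x : T.WTest N) : ℝ := T.wardLHS (T.S ρ) N x

/-- The left-hand side of (VIII.6) for the ultraviolet-limit Schwinger functions.
[cite: MagnenRivasseauSeneor1993, (VIII.6) p.378] -/
def wardLHSLim (N : ℕ) (x : T.WTest N) : ℝ := T.wardLHS T.Slim N x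

end AxialTheory

/-- First half of the main statement: *«The ultraviolet limit as ρ → ∞ of the Schwinger functions which are the
moments of the bare measure defined below in (II.77) [sic: (II.78)] exists»* — read test-datum-wise (module
docstring, Readings (i)). [cite: MagnenRivasseauSeneor1993, p.327 tl.40–41] -/
def UVLimitExistsPrinted (T : AxialTheory) : Prop :=
  ∀ (N : ℕ) (f : T.Test N), ∃ L : ℝ, Tendsto (fun ρ => T.S ρ N f) atTop (𝓝 L)

/-- Second half of the main statement: *«futhermore [sic] these functions in the ultraviolet limit satisfy the Slavnov
identities (VIII.6) adapted to the particular infrared cutoff chosen»* — (VIII.6) `LHS = E_N({x_j})` for the limit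
Schwinger functions, every `N` and all Ward test data. [cite: MagnenRivasseauSeneor1993, p.327 tl.41–43 and (VIII.6) p.378] -/
def SlavnovPrinted (T : AxialTheory) : Prop :=
  ∀ (N : ℕ) (x : T.WTest N), T.wardLHSLim N x = T.E N x

/-- **The main statement of Magnen–Rivasseau–Sénéor (CMP 155, 1993), p.327 tl.39–43, AS PRINTED** (italic,
unnumbered): *«The ultraviolet limit as ρ → ∞ of the Schwinger functions which are the moments of the bare measure
defined below in (II.77) exists; futhermore these functions in the ultraviolet limit satisfy the Slavnov identities
(VIII.6) adapted to the particular infrared cutoff chosen.»* — for ONE fixed infrared cutoff and one admissible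
choice of parameters (setting (S1)–(S6) of the module docstring). STATUS IN PRINT: a claim with a self-declared
sketch of proof (p.327 tl.44–48, p.378 tl.25); typed as a predicate to be used as an explicit hypothesis, never as a
theorem. [cite: MagnenRivasseauSeneor1993, p.327 tl.39–43] -/
def MainStatementPrinted (T : AxialTheory) : Prop :=
  UVLimitExistsPrinted T ∧ SlavnovPrinted T

/-- The «approximate identities» of p.378 tl.14–20: in the theory with both cutoffs and the gauge-restoring
counterterms, the left-hand side of (VIII.6) with `⟨·⟩_{ax,ρ}` equals *«no longer E_N, but E_N + δ_N(ρ) because of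
the effects δ_N of the gauge transformation A → A + Dγ on the ultraviolet cutoff and on the gauge restoring
counterterms»*; `δ N x ρ` = `δ_N(ρ)` at Ward test datum `x`. [cite: MagnenRivasseauSeneor1993, p.378 tl.14–20] -/
def ApproximateSlavnovPrinted (T : AxialTheory) (δ : (N : ℕ) → T.WTest N → ℕ → ℝ) : Prop :=
  ∀ (N : ℕ) (x : T.WTest N) (ρ : ℕ), T.wardLHSCutoff ρ N x = T.E N x + δ N x ρ

/-- p.378 tl.20–22: *«When ρ → ∞, the left-hand side, made of normalized Schwinger functions with cutoff ρ, by
definition tends to the same Schwinger functions without ultraviolet cutoff that we have constructed»* — the cutoff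
left-hand sides converge to the left-hand side built on the limit Schwinger functions. (In print «by definition»; as
a statement about `wardLHS` it is the passage to the limit inside the finitely many Schwinger functions (VIII.6) is
made of, recorded here as an explicit ingredient.) [cite: MagnenRivasseauSeneor1993, p.378 tl.20–22] -/
def WardLimitPrinted (T : AxialTheory) : Prop :=
  ∀ (N : ℕ) (x : T.WTest N), Tendsto (fun ρ => T.wardLHSCutoff ρ N x) atTop (𝓝 (T.wardLHSLim N x))

/-- p.378 tl.22–24: *«Our expansion proves that in the right-hand side the error term δ_N(ρ) tends to zero, because
it is made of contributions tied to the ultraviolet cutoff»* — the statement (its proof is the paper's expansion,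
Sects. IV–VII, self-described as a sketch; nothing of it is formalised). [cite: MagnenRivasseauSeneor1993, p.378 tl.22–24] -/
def ErrorTermVanishesPrinted (T : AxialTheory) (δ : (N : ℕ) → T.WTest N → ℕ → ℝ) : Prop :=
  ∀ (N : ℕ) (x : T.WTest N), Tendsto (δ N x) atTop (𝓝 0)

/-- The Sect. VIII reduction, kernel-checked: approximate identities `LHS_ρ = E_N + δ_N(ρ)`, `LHS_ρ → LHS_∞` and
`δ_N(ρ) → 0` give (VIII.6) for the limit functions (uniqueness of limits in `ℝ`). This is the entire logical content
of p.378 tl.13–25; the analytic content is in the three hypotheses. [cite: MagnenRivasseauSeneor1993, p.378 tl.13–25] -/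
theorem slavnovPrinted_of_approximate (T : AxialTheory) (δ : (N : ℕ) → T.WTest N → ℕ → ℝ)
    (happrox : ApproximateSlavnovPrinted T δ) (hlim : WardLimitPrinted T) (hδ : ErrorTermVanishesPrinted T δ) :
    SlavnovPrinted T := by
  intro N x
  have h1 : Tendsto (fun ρ => T.wardLHSCutoff ρ N x) atTop (𝓝 (T.E N x + 0)) := by
    have : (fun ρ => T.wardLHSCutoff ρ N x) = fun ρ => T.E N x + δ N x ρ := funext (happrox N x)
    rw [this]
    exact tendsto_const_nhds.add (hδ N x)
  rw [add_zero] at h1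
  exact tendsto_nhds_unique (hlim N x) h1

/-- The printed architecture of the sketch of proof, assembled: existence of the ultraviolet limit (first half,
Sects. IV–VII) together with the three ingredients of p.378 yields `MainStatementPrinted`.
[cite: MagnenRivasseauSeneor1993, p.378 tl.13–25] -/
theorem mainStatementPrinted_of_sectVIII (T : AxialTheory) (δ : (N : ℕ) → T.WTest N → ℕ → ℝ)
    (huv : UVLimitExistsPrinted T) (happrox : ApproximateSlavnovPrinted T δ) (hlim : WardLimitPrinted T)
    (hδ : ErrorTermVanishesPrinted T δ) : MainStatementPrinted T :=
  ⟨huv, slavnovPrinted_of_approximate T δ happrox hlim hδ⟩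

/-- Conversely the approximate identities hold tautologically with `δ_N(ρ) := LHS_ρ − E_N`; what the paper must (and
says it does) prove is that THIS `δ` tends to `0`. With that choice, `MainStatementPrinted` together with the
passage to the limit gives back `δ_N(ρ) → 0` — so, given `WardLimitPrinted`, (VIII.6) for the limit and the vanishing
of the error term are EQUIVALENT. [cite: MagnenRivasseauSeneor1993, p.378 tl.13–25] -/
theorem errorTerm_tendsto_zero_of_mainStatement (T : AxialTheory) (hmain : MainStatementPrinted T)
    (hlim : WardLimitPrinted T) :
    ErrorTermVanishesPrinted T (fun N x ρ => T.wardLHSCutoff ρ N x - T.E N x) := by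
  intro N x
  have h := (hlim N x).sub_const (T.E N x)
  rw [hmain.2 N x, sub_self] at h
  exact h

/-- The tautological error term satisfies the approximate identities. [cite: MagnenRivasseauSeneor1993, p.378 tl.14–20] -/
theorem approximateSlavnov_canonical (T : AxialTheory) :
    ApproximateSlavnovPrinted T (fun N x ρ => T.wardLHSCutoff ρ N x - T.E N x) := by
  intro N x ρ
  simp

/-- Under the first half of the statement every cutoff Schwinger function converges to `Slim`.
[cite: MagnenRivasseauSeneor1993, p.327 tl.40–41] -/
theorem tendsto_Slim_of_uvLimitExists {T : AxialTheory} (h : UVLimitExistsPrinted T) (N : ℕ) (f : T.Test N) :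
    Tendsto (fun ρ => T.S ρ N f) atTop (𝓝 (T.Slim N f)) :=
  T.Slim_spec (h N f)

/-! ## The thresholds «η sufficiently small», «C large» — our reading -/

/-- The construction read as a map from the two printed thresholds to the carrier: `η` = the plateau parameter of
the cutoff (II.14) (*«a small constant»*, p.331 tl.9; *«taking η sufficiently small»* tl.11–12; Lemma VI.1 p.369
*«For a sufficiently wide ultraviolet cutoff (in the sense of the parameter η in (II.14) being small)»*) and `C` =
the constant of the bare-coupling ansatz (II.11) (*«where C is a large constant»*, p.330 tl.21) — everything else
(infrared cutoff, M, ζ, ε₁, ε₂, N, the profile τ, ρ₂(ρ), ρ₁(ρ)) fixed inside the map.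
[cite: MagnenRivasseauSeneor1993, (II.11) p.330 and (II.14) p.331] -/
def Construction : Type 1 := ℝ → ℝ → AxialTheory

/-- OUR READING of the printed side conditions (the print fixes no order between the two thresholds): the main
statement holds for all sufficiently small `η > 0` and then, for each such `η`, for all sufficiently large `C`.
Flagged as a reading; `MainStatementPrinted` itself carries no thresholds. [cite: MagnenRivasseauSeneor1993, p.327 tl.39–43, p.330 tl.21, p.331 tl.9–12] -/
def MainStatementEventually (𝒞 : Construction) : Prop :=
  ∀ᶠ η in 𝓝[>] (0 : ℝ), ∀ᶠ C in atTop, MainStatementPrinted (𝒞 η C)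

/-- The reading with explicit thresholds: `∃ η₀ > 0, ∀ η ∈ (0, η₀), ∃ C₀, ∀ C ≥ C₀, …` implies the filter form.
[cite: MagnenRivasseauSeneor1993, p.330 tl.21, p.331 tl.9–12] -/
theorem mainStatementEventually_of_thresholds (𝒞 : Construction) {η₀ : ℝ} (hη₀ : 0 < η₀)
    (h : ∀ η, 0 < η → η < η₀ → ∃ C₀ : ℝ, ∀ C, C₀ ≤ C → MainStatementPrinted (𝒞 η C)) :
    MainStatementEventually 𝒞 := by
  have hmem : Set.Ioo (0 : ℝ) η₀ ∈ 𝓝[>] (0 : ℝ) := Ioo_mem_nhdsGT hη₀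
  filter_upwards [hmem] with η hη
  obtain ⟨C₀, hC₀⟩ := h η hη.1 hη.2
  exact eventually_atTop.mpr ⟨C₀, hC₀⟩

end MainStatement

end Literature.MathematicalPhysics.QuantumFieldTheory.MagnenRivasseauSeneor1993
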